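import Literature.NumberTheory.GelbartRogawski1991.UnitaryDualPairWeilCoinvariantsTwist
import Literature.NumberTheory.GelbartRogawski1991.UnitaryDualPairWeilCoinvariantsSmooth
import Literature.NumberTheory.GelbartRogawski1991.UnitaryDualPairWeilCoinvariantsReference
import Literature.NumberTheory.GelbartRogawski1991.UnitaryDualPairThetaKernel
import Literature.RepresentationTheory.TwistedCoinvariantsVanishing
import HarnessLib

/-!
# Weil coinvariants of a NON-smooth compatible pair splitting admit no non-zero map to a smooth module

Topic `NumberTheory/GelbartRogawski1991`; namespace
`Literature.NumberTheory.GelbartRogawski1991.UnitaryDualPair.WeilCoinv`.  Kernel only (theorems over landed tree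
files; 0 definitions, 0 records, 0 named facts, no `sorry`).

[GelbartRogawski1991, §3.1 Remark p. 457 L4–13]: any other compatible splitting `s*` of the metaplectic cover over the
unitary dual pair is `s ⊗ ν′` for a character `ν′` of `G₁(𝔸)` with values in the central `ℂˣ` — and NOTHING forces
`ν′` to be continuous when `s*` is merely a homomorphic section (`SplittingDatum.IsCompatible` carries no continuity;
continuity lives only inside the existential `SplittingDatum.CompatibleSplitting` of Prop. 3.1.1).  For the finite
Weil representation `ω_f ∘ s_pair` (`finPairRep`, `UnitaryDualPairWeilCoinvariants.lean`) and its `χ`-coinvariants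
`Ω(s, χ) = weilCoinv χ hs` this file proves the smooth-representation-theory consequence
([BernsteinZelevinsky1976, §2.1]: a vector fixed by an open subgroup on which a scalar twist is non-trivial is `0`):

* §1 `finPairRepV_twist_smooth` / `finPairRepW_twist_smooth` — along a twist `s ⊗ ĉ` whose `U(J_V)`- (resp.
  `U(J_W)`-) part `twistCharV ĉ` (resp. `twistCharW ĉ`) is trivial on an OPEN subgroup, smoothness of the member
  `finPairRepV` (resp. `finPairRepW`) passes from `s` to `s ⊗ ĉ` (`finPairRepV_twist`: `ω_f^{s ⊗ ĉ}(k,1) = ĉ_V(k) • ω_f^{s}(k,1)`);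
* §2 `linearMap_eq_zero_of_twistCharV` — if `twistCharV ĉ` is non-trivial on EVERY open subgroup of `U(J_V)(𝔸_{F,f})`
  and `Ω(s, χ)` is smooth, then every `ℂ`-linear map `Ω(s ⊗ ĉ, ĉ_W·χ) → H` intertwining `weilCoinv` with a SMOOTH
  representation `σ` of `U(J_V)(𝔸_{F,f})` on `H` is `0` (transport along `weilCoinvTwistEquiv` and its intertwining law
  `weilCoinvTwistEquiv_weilCoinv`, then `TwistedCoinv.linearMap_eq_zero_of_twist`);
  `subsingleton_coinv_twist` — if `χ` is non-trivial on every open subgroup of `U(J_W)(𝔸_{F,f})` and `finPairRepW hs`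
  is smooth, then `Ω(s ⊗ ĉ, ĉ_W·χ) ≃ Ω(s, χ)` is `0` (`TwistedCoinv.subsingleton_of_forall_exists_ne_one`);
* §3 **`linearMap_eq_zero_of_not_smooth`** — the DICHOTOMY for an ARBITRARY compatible splitting `s` of a datum
  carrying [GR91, Prop. 3.1.1] (`hGR : CompatibleSplitting`): either both members of `ω_f ∘ s_pair` are smooth, or, for
  every character `χ` of `U(J_W)(𝔸_{F,f})` with open kernel and every smooth `σ`, every `weilCoinv χ hs`-to-`σ`
  intertwiner `Ω(s, χ) → H` vanishes.  Proof: `s = s₀ ⊗ ĉ` for the continuous compatible `s₀ := splittingOf hGR`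
  (`adelicMpCont.exists_eq_twist`, `AdelicMetaplecticTwistCharacter.lean`), `ω_f ∘ s₀_pair` is smooth
  (`finPairRepV_smooth`, `finPairRepW_smooth`, `weilCoinv_smooth` of `UnitaryDualPairWeilCoinvariantsSmooth.lean`),
  and a case split on whether `ĉ_V`, then `ĉ_W⁻¹·χ`, kill an open subgroup.

Use (HC_CM programme, X3-Char item (F), tree side): at an index line of the pinned Liu dictionary whose compatible
pair splitting has a non-smooth finite Weil representation there is no Liu object `ω(μ, ε, χ)` ([Liu2021, Def. 4.11]
records `ω(μ, ε, χ)` as a smooth — indeed irreducible admissible — representation), and by §3 every equivariant map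
from its `Ω(s, χ)` to a smooth module (the Betti tower) is zero, so its `μ`-block is `⊥` and the [Liu2021, Thm. 4.18]
clause holds there vacuously.  Nothing about the pin is stated in this file.

## References
* [GelbartRogawski1991] S. Gelbart, J. Rogawski, *L-functions and Fourier–Jacobi coefficients for the unitary group
  U(3)*, Invent. Math. 105 (1991), §3.1 Prop. 3.1.1 p. 455 L1–3, Remark p. 457 L4–13.
* [BernsteinZelevinsky1976] I. N. Bernstein, A. V. Zelevinsky, *Representations of the group GL(n, F) where F is a
  non-archimedean local field*, Russian Math. Surveys 31:3 (1976), §2.1 (smooth representations).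
* [Liu2021] Y. Liu, *Fourier–Jacobi cycles and arithmetic relative trace formula*, Camb. J. Math. 9 (2021) =
  arXiv:2102.11518, Def. 4.11 (l. 2092–2096).
-/

set_option autoImplicit false

noncomputable section

namespace Literature.NumberTheory.GelbartRogawski1991.UnitaryDualPair.WeilCoinv

open Literature.NumberTheory.GelbartRogawski1991 Literature.NumberTheory.GelbartRogawski1991.UnitaryDualPair
open Literature.NumberTheory.Automorphic Literature.NumberTheory.Weil1964
open Literature.RepresentationTheory
open scoped Kronecker
open NumberField

variable (F E : Type) [Field F] [NumberField F] [Field E] [NumberField E] [Algebra F E]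
variable (c : E ≃ₐ[F] E) (N M : ℕ) {n : ℕ} (e : Fin N × Fin M ≃ Fin n)
variable (JV : Matrix (Fin N) (Fin N) E) (JW : Matrix (Fin M) (Fin M) E)
variable {TV : Matrix (Fin N) (Fin N) F} {TW : Matrix (Fin M) (Fin M) F}
variable [Algebra.IsQuadraticExtension F E] {δ : E} (hcδ : c δ = -δ) (hδ : δ ≠ 0) {d : F}
  (hd : δ * δ = algebraMap F E d) (hV : TV.IsSymm) (hW : TW.IsSymm) (hVd : IsUnit TV.det) (hWd : IsUnit TW.det)
  (hJV : JV = TV.map (algebraMap F E)) (hJW : JW = TW.map (algebraMap F E))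
  {s : UnitaryGroup.adelicPair F E c N M JV JW →* adelicMpCont F (Fin n) (adelicGram F e TV TW)}

/-! ### §1. Smoothness along a central twist trivial on an open subgroup -/

section Twist

variable (ĉ : UnitaryGroup.adelicPair F E c N M JV JW →* ℂˣ)
  (hs : (splittingDatum F E c N M e JV JW hcδ hδ hd hV hW hVd hWd hJV hJW).IsCompatible s)
  (hs' : (splittingDatum F E c N M e JV JW hcδ hδ hd hV hW hVd hWd hJV hJW).IsCompatible
    (adelicMpCont.twist F (Fin n) (adelicGram F e TV TW) s ĉ))

/-- **`U(J_V)`-smoothness passes along a twist `s ⊗ ĉ` with `ĉ_V` trivial on an open subgroup**: if every vector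
of `𝒮((𝔸_F^∞)^{NM})` is fixed by `ω_f^{s}(k, 1)` for `k` in some open subgroup, and `twistCharV ĉ = 1` on an open
subgroup, then every vector is fixed by `ω_f^{s ⊗ ĉ}(k, 1) = ĉ_V(k) • ω_f^{s}(k, 1)` on the (open) intersection.
[cite: GelbartRogawski1991, §3.1 Remark p. 457 L4–13] -/
theorem finPairRepV_twist_smooth
    (hsm : ∀ v : FinSB F (Fin N × Fin M), ∃ K : Subgroup (UnitaryGroup.finAdelic F E c N JV),
      IsOpen (K : Set (UnitaryGroup.finAdelic F E c N JV)) ∧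
        ∀ k ∈ K, finPairRepV F E c N M e JV JW hcδ hδ hd hV hW hVd hWd hJV hJW hs k v = v)
    (hK : ∃ K : Subgroup (UnitaryGroup.finAdelic F E c N JV),
      IsOpen (K : Set (UnitaryGroup.finAdelic F E c N JV)) ∧ ∀ k ∈ K, twistCharV F E c N M JV JW ĉ k = 1)
    (v : FinSB F (Fin N × Fin M)) :
    ∃ K : Subgroup (UnitaryGroup.finAdelic F E c N JV), IsOpen (K : Set (UnitaryGroup.finAdelic F E c N JV)) ∧
      ∀ k ∈ K, finPairRepV F E c N M e JV JW hcδ hδ hd hV hW hVd hWd hJV hJW hs' k v = v := by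
  obtain ⟨K₁, hK₁, h₁⟩ := hsm v
  obtain ⟨K₂, hK₂, h₂⟩ := hK
  refine ⟨K₁ ⊓ K₂, ?_, fun k hk => ?_⟩
  · rw [Subgroup.coe_inf]
    exact hK₁.inter hK₂
  · rw [finPairRepV_twist F E c N M e JV JW hcδ hδ hd hV hW hVd hWd hJV hJW ĉ hs hs' k v,
      h₂ k (Subgroup.mem_inf.1 hk).2, h₁ k (Subgroup.mem_inf.1 hk).1, Units.val_one, one_smul]

/-- **`U(J_W)`-smoothness passes along a twist `s ⊗ ĉ` with `ĉ_W` trivial on an open subgroup** (the same for the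
member `u ↦ ω_f(s_pair(1, (1,u)))`, `finPairRepW_twist`). [cite: GelbartRogawski1991, §3.1 Remark p. 457 L4–13] -/
theorem finPairRepW_twist_smooth
    (hsm : ∀ v : FinSB F (Fin N × Fin M), ∃ K : Subgroup (UnitaryGroup.finAdelic F E c M JW),
      IsOpen (K : Set (UnitaryGroup.finAdelic F E c M JW)) ∧
        ∀ u ∈ K, finPairRepW F E c N M e JV JW hcδ hδ hd hV hW hVd hWd hJV hJW hs u v = v)
    (hK : ∃ K : Subgroup (UnitaryGroup.finAdelic F E c M JW),
      IsOpen (K : Set (UnitaryGroup.finAdelic F E c M JW)) ∧ ∀ u ∈ K, twistCharW F E c N M JV JW ĉ u = 1)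
    (v : FinSB F (Fin N × Fin M)) :
    ∃ K : Subgroup (UnitaryGroup.finAdelic F E c M JW), IsOpen (K : Set (UnitaryGroup.finAdelic F E c M JW)) ∧
      ∀ u ∈ K, finPairRepW F E c N M e JV JW hcδ hδ hd hV hW hVd hWd hJV hJW hs' u v = v := by
  obtain ⟨K₁, hK₁, h₁⟩ := hsm v
  obtain ⟨K₂, hK₂, h₂⟩ := hK
  refine ⟨K₁ ⊓ K₂, ?_, fun u hu => ?_⟩
  · rw [Subgroup.coe_inf]
    exact hK₁.inter hK₂
  · rw [finPairRepW_twist F E c N M e JV JW hcδ hδ hd hV hW hVd hWd hJV hJW ĉ hs hs' u v,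
      h₂ u (Subgroup.mem_inf.1 hu).2, h₁ u (Subgroup.mem_inf.1 hu).1, Units.val_one, one_smul]

/-! ### §2. Vanishing along a twist that is non-trivial on every open subgroup -/

/-- **Generic form** ([BernsteinZelevinsky1976, §2.1], transport along an equivalence): if `E : M₁ ≃ M₂` carries the
`G`-action `π₁` to the `c`-TWIST of a smooth action `π₂` (`E (π₁ g x) = c g • π₂ g (E x)`), `σ` is smooth on `H`, and
the scalar `c` takes a value `≠ 1` on every open subgroup of `G`, then every `ℂ`-linear `ψ : M₁ → H` with
`ψ (π₁ g x) = σ g (ψ x)` is `0` (`ψ ∘ E⁻¹` is a twisted intertwiner between smooth modules).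
[cite: BernsteinZelevinsky1976, §2.1] -/
theorem linearMap_eq_zero_of_twisted_equiv {k : Type*} [Field k] {G : Type*} [Group G] [TopologicalSpace G]
    {M₁ M₂ H : Type*} [AddCommGroup M₁] [Module k M₁] [AddCommGroup M₂] [Module k M₂] [AddCommGroup H] [Module k H]
    (π₁ : Representation k G M₁) (π₂ : Representation k G M₂) (Eqv : M₁ ≃ₗ[k] M₂) (cV : G → kˣ)
    (hE : ∀ (g : G) (x : M₁), Eqv (π₁ g x) = ((cV g : kˣ) : k) • π₂ g (Eqv x))
    (hsm₂ : ∀ y : M₂, ∃ K : Subgroup G, IsOpen (K : Set G) ∧ ∀ g ∈ K, π₂ g y = y)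
    (σ : Representation k G H) (hσ : ∀ y : H, ∃ K : Subgroup G, IsOpen (K : Set G) ∧ ∀ g ∈ K, σ g y = y)
    (hc : ∀ K : Subgroup G, IsOpen (K : Set G) → ∃ g ∈ K, cV g ≠ 1)
    (ψ : M₁ →ₗ[k] H) (hψ : ∀ (g : G) (x : M₁), ψ (π₁ g x) = σ g (ψ x)) : ψ = 0 := by
  have key : ∀ (g : G) (y : M₂),
      (ψ ∘ₗ Eqv.symm.toLinearMap) (((cV g : kˣ) : k) • π₂ g y) = σ g ((ψ ∘ₗ Eqv.symm.toLinearMap) y) := by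
    intro g y
    obtain ⟨x, rfl⟩ := Eqv.surjective y
    rw [← hE g x]
    simp only [LinearMap.coe_comp, Function.comp_apply, LinearEquiv.coe_coe, LinearEquiv.symm_apply_apply]
    exact hψ g x
  have h0 := TwistedCoinv.linearMap_eq_zero_of_twist π₂ σ hsm₂ hσ cV hc (ψ ∘ₗ Eqv.symm.toLinearMap) key
  refine LinearMap.ext fun x => ?_
  simpa using LinearMap.congr_fun h0 (Eqv x)

/-- **A discontinuous `U(J_V)`-twist kills every intertwiner into a smooth module.**  Let `Ω(s, χ)` be smooth
(every class fixed by an open subgroup of `U(J_V)(𝔸_{F,f})`), let `σ` be a smooth representation of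
`U(J_V)(𝔸_{F,f})` on `H`, and let `twistCharV ĉ` take a value `≠ 1` on EVERY open subgroup.  Then every `ℂ`-linear
`ψ : Ω(s ⊗ ĉ, χ') → H` (`χ' = ĉ_W · χ`) with `ψ ∘ Ω(s ⊗ ĉ, χ')(k) = σ(k) ∘ ψ` is `0`: along
`E = weilCoinvTwistEquiv` the map `ψ ∘ E⁻¹` intertwines the `ĉ_V`-twisted smooth action on `Ω(s, χ)` with `σ`
(`weilCoinvTwistEquiv_weilCoinv`), and such a map vanishes ([BernsteinZelevinsky1976, §2.1]).
[cite: GelbartRogawski1991, §3.1 Remark p. 457 L4–13] [cite: BernsteinZelevinsky1976, §2.1] -/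
theorem linearMap_eq_zero_of_twistCharV
    {χ χ' : UnitaryGroup.finAdelic F E c M JW →* ℂˣ} (hχ : ∀ u, χ' u = twistCharW F E c N M JV JW ĉ u * χ u)
    (hsmΩ : ∀ x : TwistedCoinv.Coinv (finPairRepW F E c N M e JV JW hcδ hδ hd hV hW hVd hWd hJV hJW hs) χ,
      ∃ K : Subgroup (UnitaryGroup.finAdelic F E c N JV), IsOpen (K : Set (UnitaryGroup.finAdelic F E c N JV)) ∧
        ∀ k ∈ K, weilCoinv F E c N M e JV JW hcδ hδ hd hV hW hVd hWd hJV hJW χ hs k x = x)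
    {H : Type*} [AddCommGroup H] [Module ℂ H] (σ : Representation ℂ (UnitaryGroup.finAdelic F E c N JV) H)
    (hσ : ∀ y : H, ∃ K : Subgroup (UnitaryGroup.finAdelic F E c N JV),
      IsOpen (K : Set (UnitaryGroup.finAdelic F E c N JV)) ∧ ∀ k ∈ K, σ k y = y)
    (hcV : ∀ K : Subgroup (UnitaryGroup.finAdelic F E c N JV), IsOpen (K : Set (UnitaryGroup.finAdelic F E c N JV)) →
      ∃ k ∈ K, twistCharV F E c N M JV JW ĉ k ≠ 1)
    (ψ : TwistedCoinv.Coinv (finPairRepW F E c N M e JV JW hcδ hδ hd hV hW hVd hWd hJV hJW hs') χ' →ₗ[ℂ] H)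
    (hψ : ∀ (k : UnitaryGroup.finAdelic F E c N JV)
      (x : TwistedCoinv.Coinv (finPairRepW F E c N M e JV JW hcδ hδ hd hV hW hVd hWd hJV hJW hs') χ'),
      ψ (weilCoinv F E c N M e JV JW hcδ hδ hd hV hW hVd hWd hJV hJW χ' hs' k x) = σ k (ψ x)) :
    ψ = 0 :=
  linearMap_eq_zero_of_twisted_equiv (weilCoinv F E c N M e JV JW hcδ hδ hd hV hW hVd hWd hJV hJW χ' hs')
    (weilCoinv F E c N M e JV JW hcδ hδ hd hV hW hVd hWd hJV hJW χ hs)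
    (weilCoinvTwistEquiv F E c N M e JV JW hcδ hδ hd hV hW hVd hWd hJV hJW ĉ hs hs' hχ)
    (fun k => twistCharV F E c N M JV JW ĉ k)
    (weilCoinvTwistEquiv_weilCoinv F E c N M e JV JW hcδ hδ hd hV hW hVd hWd hJV hJW ĉ hs hs' hχ) hsmΩ σ hσ hcV ψ hψ

/-- contrapositive: a NON-ZERO intertwiner `Ω(s ⊗ ĉ, χ') → H` into a smooth `σ` forces `twistCharV ĉ` to be trivial on
some open subgroup of `U(J_V)(𝔸_{F,f})` (hence continuous there).
[cite: GelbartRogawski1991, §3.1 Remark p. 457 L4–13] [cite: BernsteinZelevinsky1976, §2.1] -/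
theorem exists_isOpen_forall_twistCharV_eq_one_of_ne_zero
    {χ χ' : UnitaryGroup.finAdelic F E c M JW →* ℂˣ} (hχ : ∀ u, χ' u = twistCharW F E c N M JV JW ĉ u * χ u)
    (hsmΩ : ∀ x : TwistedCoinv.Coinv (finPairRepW F E c N M e JV JW hcδ hδ hd hV hW hVd hWd hJV hJW hs) χ,
      ∃ K : Subgroup (UnitaryGroup.finAdelic F E c N JV), IsOpen (K : Set (UnitaryGroup.finAdelic F E c N JV)) ∧
        ∀ k ∈ K, weilCoinv F E c N M e JV JW hcδ hδ hd hV hW hVd hWd hJV hJW χ hs k x = x)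
    {H : Type*} [AddCommGroup H] [Module ℂ H] (σ : Representation ℂ (UnitaryGroup.finAdelic F E c N JV) H)
    (hσ : ∀ y : H, ∃ K : Subgroup (UnitaryGroup.finAdelic F E c N JV),
      IsOpen (K : Set (UnitaryGroup.finAdelic F E c N JV)) ∧ ∀ k ∈ K, σ k y = y)
    (ψ : TwistedCoinv.Coinv (finPairRepW F E c N M e JV JW hcδ hδ hd hV hW hVd hWd hJV hJW hs') χ' →ₗ[ℂ] H)
    (hψ : ∀ (k : UnitaryGroup.finAdelic F E c N JV)
      (x : TwistedCoinv.Coinv (finPairRepW F E c N M e JV JW hcδ hδ hd hV hW hVd hWd hJV hJW hs') χ'),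
      ψ (weilCoinv F E c N M e JV JW hcδ hδ hd hV hW hVd hWd hJV hJW χ' hs' k x) = σ k (ψ x))
    (hne : ψ ≠ 0) :
    ∃ K : Subgroup (UnitaryGroup.finAdelic F E c N JV), IsOpen (K : Set (UnitaryGroup.finAdelic F E c N JV)) ∧
      ∀ k ∈ K, twistCharV F E c N M JV JW ĉ k = 1 := by
  by_contra hcon
  push Not at hcon
  exact hne (linearMap_eq_zero_of_twistCharV F E c N M e JV JW hcδ hδ hd hV hW hVd hWd hJV hJW ĉ hs hs' hχ hsmΩ σ hσ
    hcon ψ hψ)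

/-- **A discontinuous `U(J_W)`-character kills the coinvariants**: if `finPairRepW hs` is smooth and `χ` is
non-trivial on EVERY open subgroup of `U(J_W)(𝔸_{F,f})`, then `Ω(s ⊗ ĉ, χ') ≃ Ω(s, χ) = 0` (`χ' = ĉ_W · χ`;
`weilCoinvTwistEquiv` and [BernsteinZelevinsky1976, §2.1] for coinvariants).
[cite: GelbartRogawski1991, §3.1 Remark p. 457 L4–13] [cite: BernsteinZelevinsky1976, §2.1] -/
theorem subsingleton_coinv_twist
    {χ χ' : UnitaryGroup.finAdelic F E c M JW →* ℂˣ} (hχ : ∀ u, χ' u = twistCharW F E c N M JV JW ĉ u * χ u)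
    (hsm : ∀ v : FinSB F (Fin N × Fin M), ∃ K : Subgroup (UnitaryGroup.finAdelic F E c M JW),
      IsOpen (K : Set (UnitaryGroup.finAdelic F E c M JW)) ∧
        ∀ u ∈ K, finPairRepW F E c N M e JV JW hcδ hδ hd hV hW hVd hWd hJV hJW hs u v = v)
    (hcW : ∀ K : Subgroup (UnitaryGroup.finAdelic F E c M JW), IsOpen (K : Set (UnitaryGroup.finAdelic F E c M JW)) →
      ∃ u ∈ K, χ u ≠ 1) :
    Subsingleton (TwistedCoinv.Coinv (finPairRepW F E c N M e JV JW hcδ hδ hd hV hW hVd hWd hJV hJW hs') χ') :=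
  haveI : Subsingleton (TwistedCoinv.Coinv (finPairRepW F E c N M e JV JW hcδ hδ hd hV hW hVd hWd hJV hJW hs) χ) :=
    TwistedCoinv.subsingleton_of_forall_exists_ne_one _ χ hsm hcW
  (weilCoinvTwistEquiv F E c N M e JV JW hcδ hδ hd hV hW hVd hWd hJV hJW ĉ hs hs' hχ).toEquiv.subsingleton

end Twist

/-! ### §3. The dichotomy for an arbitrary compatible splitting -/

/-- **Weil coinvariants of a NON-smooth compatible splitting have no non-zero equivariant map to a smooth module.**
Let the datum carry [GR91, Prop. 3.1.1] (`hGR`, a continuous compatible splitting exists) and let `s` be ANY compatible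
splitting (a homomorphic section, no continuity assumed).  If the finite Weil representation `ω_f ∘ s_pair` is NOT
smooth — some vector of `𝒮((𝔸_F^∞)^{NM})` is moved by every open subgroup of `U(J_V)(𝔸_{F,f})`, or by every open
subgroup of `U(J_W)(𝔸_{F,f})` — then for every character `χ` of `U(J_W)(𝔸_{F,f})` with open kernel and every smooth
representation `σ` of `U(J_V)(𝔸_{F,f})` on `H`, every `ℂ`-linear `ψ : Ω(s, χ) → H` with
`ψ ∘ Ω(s, χ)(k) = σ(k) ∘ ψ` is `0`.  Proof: `s = s₀ ⊗ ĉ` with `s₀ := splittingOf hGR` continuous compatible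
(`adelicMpCont.exists_eq_twist`; [GR91, Remark p. 457]); `ω_f ∘ s₀_pair` and `Ω(s₀, ·)` are smooth
(`finPairRepV_smooth`, `finPairRepW_smooth`, `weilCoinv_smooth`); if `ĉ_V` moves every open subgroup, §2 applies;
otherwise `ω_f^{s}` is `U(J_V)`-smooth (§1), so by hypothesis it is not `U(J_W)`-smooth, hence `ĉ_W` — equivalently
`ĉ_W⁻¹·χ`, `χ` having open kernel — moves every open subgroup and `Ω(s, χ) = 0` (§2).
[cite: GelbartRogawski1991, §3.1 Prop. 3.1.1 p. 455 L1–3, Remark p. 457 L4–13] [cite: BernsteinZelevinsky1976, §2.1] -/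
theorem linearMap_eq_zero_of_not_smooth
    (hGR : (splittingDatum F E c N M e JV JW hcδ hδ hd hV hW hVd hWd hJV hJW).CompatibleSplitting)
    (hs : (splittingDatum F E c N M e JV JW hcδ hδ hd hV hW hVd hWd hJV hJW).IsCompatible s)
    (hns : ¬ ((∀ v : FinSB F (Fin N × Fin M), ∃ K : Subgroup (UnitaryGroup.finAdelic F E c N JV),
                IsOpen (K : Set (UnitaryGroup.finAdelic F E c N JV)) ∧
                  ∀ k ∈ K, finPairRepV F E c N M e JV JW hcδ hδ hd hV hW hVd hWd hJV hJW hs k v = v) ∧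
              ∀ v : FinSB F (Fin N × Fin M), ∃ K : Subgroup (UnitaryGroup.finAdelic F E c M JW),
                IsOpen (K : Set (UnitaryGroup.finAdelic F E c M JW)) ∧
                  ∀ u ∈ K, finPairRepW F E c N M e JV JW hcδ hδ hd hV hW hVd hWd hJV hJW hs u v = v))
    {χ : UnitaryGroup.finAdelic F E c M JW →* ℂˣ}
    (hχ : IsOpen ((χ.ker : Subgroup (UnitaryGroup.finAdelic F E c M JW)) : Set (UnitaryGroup.finAdelic F E c M JW)))
    {H : Type*} [AddCommGroup H] [Module ℂ H] (σ : Representation ℂ (UnitaryGroup.finAdelic F E c N JV) H)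
    (hσ : ∀ y : H, ∃ K : Subgroup (UnitaryGroup.finAdelic F E c N JV),
      IsOpen (K : Set (UnitaryGroup.finAdelic F E c N JV)) ∧ ∀ k ∈ K, σ k y = y)
    (ψ : TwistedCoinv.Coinv (finPairRepW F E c N M e JV JW hcδ hδ hd hV hW hVd hWd hJV hJW hs) χ →ₗ[ℂ] H)
    (hψ : ∀ (k : UnitaryGroup.finAdelic F E c N JV)
      (x : TwistedCoinv.Coinv (finPairRepW F E c N M e JV JW hcδ hδ hd hV hW hVd hWd hJV hJW hs) χ),
      ψ (weilCoinv F E c N M e JV JW hcδ hδ hd hV hW hVd hWd hJV hJW χ hs k x) = σ k (ψ x)) :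
    ψ = 0 := by
  -- the continuous compatible splitting of [GR91, Prop. 3.1.1] and its smoothness
  have hs₀ := splittingOf_isCompatible F E c N M e JV JW hcδ hδ hd hV hW hVd hWd hJV hJW hGR
  have hsc₀ := continuous_pairSplitting_splittingOf F E c N M e JV JW hcδ hδ hd hV hW hVd hWd hJV hJW hGR
  -- `s = s₀ ⊗ ĉ`
  obtain ⟨ĉ, hĉ, -, -⟩ := exists_eq_twist_of_isCompatible F E c N M e JV JW hcδ hδ hd hV hW hVd hWd hJV hJW hs₀ hs
  subst hĉ
  have hsmV₀ : ∀ v : FinSB F (Fin N × Fin M), ∃ K : Subgroup (UnitaryGroup.finAdelic F E c N JV),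
      IsOpen (K : Set (UnitaryGroup.finAdelic F E c N JV)) ∧
        ∀ k ∈ K, finPairRepV F E c N M e JV JW hcδ hδ hd hV hW hVd hWd hJV hJW hs₀ k v = v := fun v => by
    obtain ⟨K, hK, -, h⟩ := exists_isOpen_isCompact_forall_finPairRepV_apply_eq_self F E c N M e JV JW hcδ hδ hd hV hW
      hVd hWd hJV hJW hsc₀ hs₀ v
    exact ⟨K, hK, h⟩
  have hsmW₀ : ∀ v : FinSB F (Fin N × Fin M), ∃ K : Subgroup (UnitaryGroup.finAdelic F E c M JW),
      IsOpen (K : Set (UnitaryGroup.finAdelic F E c M JW)) ∧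
        ∀ u ∈ K, finPairRepW F E c N M e JV JW hcδ hδ hd hV hW hVd hWd hJV hJW hs₀ u v = v := fun v => by
    obtain ⟨𝔪, h𝔪, h⟩ := finPairRepW_smooth F E c N M e JV JW hcδ hδ hd hV hW hVd hWd hJV hJW hsc₀ hs₀ v
    exact ⟨_, UnitaryGroup.isOpen_finCongruenceLevel F E c M JW h𝔪, h⟩
  -- the character `χ₀ := ĉ_W⁻¹ · χ`, so that `χ = ĉ_W · χ₀`
  have hχ₀ : ∀ u, χ u = twistCharW F E c N M JV JW ĉ u * ((twistCharW F E c N M JV JW ĉ)⁻¹ * χ) u := fun u => by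
    rw [MonoidHom.mul_apply, MonoidHom.inv_apply, mul_inv_cancel_left]
  have hsmΩ₀ : ∀ x : TwistedCoinv.Coinv (finPairRepW F E c N M e JV JW hcδ hδ hd hV hW hVd hWd hJV hJW hs₀)
      ((twistCharW F E c N M JV JW ĉ)⁻¹ * χ),
      ∃ K : Subgroup (UnitaryGroup.finAdelic F E c N JV), IsOpen (K : Set (UnitaryGroup.finAdelic F E c N JV)) ∧
        ∀ k ∈ K, weilCoinv F E c N M e JV JW hcδ hδ hd hV hW hVd hWd hJV hJW ((twistCharW F E c N M JV JW ĉ)⁻¹ * χ)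
          hs₀ k x = x := fun x => by
    obtain ⟨K, hK, -, h⟩ := exists_isOpen_isCompact_forall_weilCoinv_apply_eq_self F E c N M e JV JW hcδ hδ hd hV hW
      hVd hWd hJV hJW ((twistCharW F E c N M JV JW ĉ)⁻¹ * χ) hsc₀ hs₀ x
    exact ⟨K, hK, h⟩
  by_cases hcV : ∀ K : Subgroup (UnitaryGroup.finAdelic F E c N JV),
      IsOpen (K : Set (UnitaryGroup.finAdelic F E c N JV)) → ∃ k ∈ K, twistCharV F E c N M JV JW ĉ k ≠ 1
  · -- `ĉ_V` moves every open subgroup: §2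
    exact linearMap_eq_zero_of_twistCharV F E c N M e JV JW hcδ hδ hd hV hW hVd hWd hJV hJW ĉ hs₀ hs hχ₀ hsmΩ₀ σ hσ
      hcV ψ hψ
  · -- `ĉ_V = 1` on an open subgroup: `ω_f^{s}` is `U(J_V)`-smooth, hence NOT `U(J_W)`-smooth
    push Not at hcV
    have hsmV := finPairRepV_twist_smooth F E c N M e JV JW hcδ hδ hd hV hW hVd hWd hJV hJW ĉ hs₀ hs hsmV₀ hcV
    have hnW : ¬ ∀ v : FinSB F (Fin N × Fin M), ∃ K : Subgroup (UnitaryGroup.finAdelic F E c M JW),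
        IsOpen (K : Set (UnitaryGroup.finAdelic F E c M JW)) ∧
          ∀ u ∈ K, finPairRepW F E c N M e JV JW hcδ hδ hd hV hW hVd hWd hJV hJW hs u v = v :=
      fun hW' => hns ⟨hsmV, hW'⟩
    by_cases hcW : ∀ K : Subgroup (UnitaryGroup.finAdelic F E c M JW),
        IsOpen (K : Set (UnitaryGroup.finAdelic F E c M JW)) → ∃ u ∈ K, ((twistCharW F E c N M JV JW ĉ)⁻¹ * χ) u ≠ 1
    · -- `ĉ_W⁻¹·χ` moves every open subgroup: `Ω(s, χ) = 0`
      haveI := subsingleton_coinv_twist F E c N M e JV JW hcδ hδ hd hV hW hVd hWd hJV hJW ĉ hs₀ hs hχ₀ hsmW₀ hcW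
      exact LinearMap.ext fun x => by rw [Subsingleton.elim x 0, map_zero, LinearMap.zero_apply]
    · -- `ĉ_W⁻¹·χ = 1` on an open subgroup `K`: then `ĉ_W = 1` on `K ⊓ ker χ`, contradicting `hnW`
      push Not at hcW
      obtain ⟨K, hK, h1⟩ := hcW
      refine absurd (finPairRepW_twist_smooth F E c N M e JV JW hcδ hδ hd hV hW hVd hWd hJV hJW ĉ hs₀ hs hsmW₀
        ⟨K ⊓ χ.ker, ?_, fun u hu => ?_⟩) hnW
      · rw [Subgroup.coe_inf]
        exact hK.inter hχ
      · have hu₁ : ((twistCharW F E c N M JV JW ĉ)⁻¹ * χ) u = 1 := h1 u (Subgroup.mem_inf.1 hu).1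
        have hu₂ : χ u = 1 := (MonoidHom.mem_ker).1 (Subgroup.mem_inf.1 hu).2
        have h := hχ₀ u
        rwa [hu₁, hu₂, mul_one, eq_comm] at h

/-! ### §4. Conversely: a SMOOTH compatible splitting is the [GR91] splitting twisted by a character with open finite kernels -/

section Converse

variable (ĉ : UnitaryGroup.adelicPair F E c N M JV JW →* ℂˣ)
  (hs : (splittingDatum F E c N M e JV JW hcδ hδ hd hV hW hVd hWd hJV hJW).IsCompatible s)
  (hs' : (splittingDatum F E c N M e JV JW hcδ hδ hd hV hW hVd hWd hJV hJW).IsCompatible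
    (adelicMpCont.twist F (Fin n) (adelicGram F e TV TW) s ĉ))

/-- **If both `ω_f^{s}` and `ω_f^{s ⊗ ĉ}` are `U(J_V)`-smooth then `ĉ_V` is trivial on an open subgroup**: test on the
non-zero vector `𝟙_{𝒪̂}` (`cosetIndicatorSB 0 ⊤`, value `1` at `0`): on the intersection of the two fixing subgroups
`𝟙 = ĉ_V(k) • 𝟙`. [cite: GelbartRogawski1991, §3.1 Remark p. 457 L4–13] [cite: BernsteinZelevinsky1976, §2.1] -/
theorem exists_isOpen_forall_twistCharV_eq_one_of_smooth
    (hsm : ∀ v : FinSB F (Fin N × Fin M), ∃ K : Subgroup (UnitaryGroup.finAdelic F E c N JV),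
      IsOpen (K : Set (UnitaryGroup.finAdelic F E c N JV)) ∧
        ∀ k ∈ K, finPairRepV F E c N M e JV JW hcδ hδ hd hV hW hVd hWd hJV hJW hs k v = v)
    (hsm' : ∀ v : FinSB F (Fin N × Fin M), ∃ K : Subgroup (UnitaryGroup.finAdelic F E c N JV),
      IsOpen (K : Set (UnitaryGroup.finAdelic F E c N JV)) ∧
        ∀ k ∈ K, finPairRepV F E c N M e JV JW hcδ hδ hd hV hW hVd hWd hJV hJW hs' k v = v) :
    ∃ K : Subgroup (UnitaryGroup.finAdelic F E c N JV), IsOpen (K : Set (UnitaryGroup.finAdelic F E c N JV)) ∧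
      ∀ k ∈ K, twistCharV F E c N M JV JW ĉ k = 1 := by
  have hv₀ : cosetIndicatorSB F (Fin N × Fin M) 0 ⊤ ≠ 0 := fun h0 => by
    have h1 := cosetIndicatorSB_apply_self (F := F) (ι := Fin N × Fin M) 0 ⊤
    rw [h0] at h1
    exact one_ne_zero (h1.symm.trans rfl)
  obtain ⟨K₁, hK₁, h₁⟩ := hsm (cosetIndicatorSB F (Fin N × Fin M) 0 ⊤)
  obtain ⟨K₂, hK₂, h₂⟩ := hsm' (cosetIndicatorSB F (Fin N × Fin M) 0 ⊤)
  refine ⟨K₁ ⊓ K₂, ?_, fun k hk => ?_⟩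
  · rw [Subgroup.coe_inf]
    exact hK₁.inter hK₂
  · have h := h₂ k (Subgroup.mem_inf.1 hk).2
    rw [finPairRepV_twist F E c N M e JV JW hcδ hδ hd hV hW hVd hWd hJV hJW ĉ hs hs' k, h₁ k (Subgroup.mem_inf.1 hk).1] at h
    rw [← one_smul ℂ (cosetIndicatorSB F (Fin N × Fin M) 0 ⊤)] at h
    rw [smul_smul, mul_one] at h
    exact Units.ext (smul_left_injective ℂ hv₀ h)

/-- the same for the `U(J_W)`-member: **if both `ω_f^{s}` and `ω_f^{s ⊗ ĉ}` are `U(J_W)`-smooth then `ĉ_W` is trivial on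
an open subgroup**. [cite: GelbartRogawski1991, §3.1 Remark p. 457 L4–13] [cite: BernsteinZelevinsky1976, §2.1] -/
theorem exists_isOpen_forall_twistCharW_eq_one_of_smooth
    (hsm : ∀ v : FinSB F (Fin N × Fin M), ∃ K : Subgroup (UnitaryGroup.finAdelic F E c M JW),
      IsOpen (K : Set (UnitaryGroup.finAdelic F E c M JW)) ∧
        ∀ u ∈ K, finPairRepW F E c N M e JV JW hcδ hδ hd hV hW hVd hWd hJV hJW hs u v = v)
    (hsm' : ∀ v : FinSB F (Fin N × Fin M), ∃ K : Subgroup (UnitaryGroup.finAdelic F E c M JW),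
      IsOpen (K : Set (UnitaryGroup.finAdelic F E c M JW)) ∧
        ∀ u ∈ K, finPairRepW F E c N M e JV JW hcδ hδ hd hV hW hVd hWd hJV hJW hs' u v = v) :
    ∃ K : Subgroup (UnitaryGroup.finAdelic F E c M JW), IsOpen (K : Set (UnitaryGroup.finAdelic F E c M JW)) ∧
      ∀ u ∈ K, twistCharW F E c N M JV JW ĉ u = 1 := by
  have hv₀ : cosetIndicatorSB F (Fin N × Fin M) 0 ⊤ ≠ 0 := fun h0 => by
    have h1 := cosetIndicatorSB_apply_self (F := F) (ι := Fin N × Fin M) 0 ⊤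
    rw [h0] at h1
    exact one_ne_zero (h1.symm.trans rfl)
  obtain ⟨K₁, hK₁, h₁⟩ := hsm (cosetIndicatorSB F (Fin N × Fin M) 0 ⊤)
  obtain ⟨K₂, hK₂, h₂⟩ := hsm' (cosetIndicatorSB F (Fin N × Fin M) 0 ⊤)
  refine ⟨K₁ ⊓ K₂, ?_, fun u hu => ?_⟩
  · rw [Subgroup.coe_inf]
    exact hK₁.inter hK₂
  · have h := h₂ u (Subgroup.mem_inf.1 hu).2
    rw [finPairRepW_twist F E c N M e JV JW hcδ hδ hd hV hW hVd hWd hJV hJW ĉ hs hs' u, h₁ u (Subgroup.mem_inf.1 hu).1] at h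
    rw [← one_smul ℂ (cosetIndicatorSB F (Fin N × Fin M) 0 ⊤)] at h
    rw [smul_smul, mul_one] at h
    exact Units.ext (smul_left_injective ℂ hv₀ h)

end Converse

/-- **A SMOOTH compatible splitting is the [GR91, Prop. 3.1.1] splitting twisted by an automorphic character whose
finite `U(J_V)`- and `U(J_W)`-parts are trivial on open subgroups.**  For ANY compatible `s` whose finite Weil
representation is smooth (both members): `s = splittingOf hGR ⊗ ĉ` with `ĉ = 1` on `G₁(F)` and `twistCharV ĉ`,
`twistCharW ĉ` each trivial on an open subgroup (so the FINITE parts of `ĉ` are continuous; its archimedean part is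
not constrained here).  [`exists_eq_twist_of_isCompatible` + §4.]
[cite: GelbartRogawski1991, §3.1 Prop. 3.1.1 p. 455 L1–3, Remark p. 457 L4–13] [cite: BernsteinZelevinsky1976, §2.1] -/
theorem exists_eq_twist_openKer_of_smooth
    (hGR : (splittingDatum F E c N M e JV JW hcδ hδ hd hV hW hVd hWd hJV hJW).CompatibleSplitting)
    (hs : (splittingDatum F E c N M e JV JW hcδ hδ hd hV hW hVd hWd hJV hJW).IsCompatible s)
    (hsmV : ∀ v : FinSB F (Fin N × Fin M), ∃ K : Subgroup (UnitaryGroup.finAdelic F E c N JV),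
      IsOpen (K : Set (UnitaryGroup.finAdelic F E c N JV)) ∧
        ∀ k ∈ K, finPairRepV F E c N M e JV JW hcδ hδ hd hV hW hVd hWd hJV hJW hs k v = v)
    (hsmW : ∀ v : FinSB F (Fin N × Fin M), ∃ K : Subgroup (UnitaryGroup.finAdelic F E c M JW),
      IsOpen (K : Set (UnitaryGroup.finAdelic F E c M JW)) ∧
        ∀ u ∈ K, finPairRepW F E c N M e JV JW hcδ hδ hd hV hW hVd hWd hJV hJW hs u v = v) :
    ∃ ĉ : UnitaryGroup.adelicPair F E c N M JV JW →* ℂˣ,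
      s = adelicMpCont.twist F (Fin n) (adelicGram F e TV TW)
            (splittingOf F E c N M e JV JW hcδ hδ hd hV hW hVd hWd hJV hJW hGR) ĉ ∧
        (∀ γ ∈ (splittingDatum F E c N M e JV JW hcδ hδ hd hV hW hVd hWd hJV hJW).ratPts, ĉ γ = 1) ∧
        (∃ K : Subgroup (UnitaryGroup.finAdelic F E c N JV), IsOpen (K : Set (UnitaryGroup.finAdelic F E c N JV)) ∧
          ∀ k ∈ K, twistCharV F E c N M JV JW ĉ k = 1) ∧
        ∃ K : Subgroup (UnitaryGroup.finAdelic F E c M JW), IsOpen (K : Set (UnitaryGroup.finAdelic F E c M JW)) ∧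
          ∀ u ∈ K, twistCharW F E c N M JV JW ĉ u = 1 := by
  have hs₀ := splittingOf_isCompatible F E c N M e JV JW hcδ hδ hd hV hW hVd hWd hJV hJW hGR
  have hsc₀ := continuous_pairSplitting_splittingOf F E c N M e JV JW hcδ hδ hd hV hW hVd hWd hJV hJW hGR
  obtain ⟨ĉ, hĉ, hrat, -⟩ := exists_eq_twist_of_isCompatible F E c N M e JV JW hcδ hδ hd hV hW hVd hWd hJV hJW hs₀ hs
  subst hĉ
  refine ⟨ĉ, rfl, hrat, ?_, ?_⟩
  · refine exists_isOpen_forall_twistCharV_eq_one_of_smooth F E c N M e JV JW hcδ hδ hd hV hW hVd hWd hJV hJW ĉ hs₀ hs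
      (fun v => ?_) hsmV
    obtain ⟨K, hK, -, h⟩ := exists_isOpen_isCompact_forall_finPairRepV_apply_eq_self F E c N M e JV JW hcδ hδ hd hV hW
      hVd hWd hJV hJW hsc₀ hs₀ v
    exact ⟨K, hK, h⟩
  · refine exists_isOpen_forall_twistCharW_eq_one_of_smooth F E c N M e JV JW hcδ hδ hd hV hW hVd hWd hJV hJW ĉ hs₀ hs
      (fun v => ?_) hsmW
    obtain ⟨𝔪, h𝔪, h⟩ := finPairRepW_smooth F E c N M e JV JW hcδ hδ hd hV hW hVd hWd hJV hJW hsc₀ hs₀ v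
    exact ⟨_, UnitaryGroup.isOpen_finCongruenceLevel F E c M JW h𝔪, h⟩

end Literature.NumberTheory.GelbartRogawski1991.UnitaryDualPair.WeilCoinv

end
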